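import Mathlib
import HarnessLib
import Summits.NavierStokesRegularity.NavierStokesRegularity.Theorems.QuarterLogPincerSmoothSilenceDefs
import Literature.Analysis.FluidPDE.VorticityEquation
import Literature.Analysis.FluidPDE.AxisymmetricVorticityTransport
import Literature.Analysis.FluidPDE.KNSSThm52Integrand

/-!
# Route `QuarterLogPincer`, crux `TypeIQuantSubcubicExp` (stmt-NavierStokesRegularity-24077), line `smooth_silence` —
# Sv♯ `stub_vorticityTransport : VorticityTransport` BY NAME (the vorticity-transport bridge, one order up)

ns-idea-7's line `Cruxes/TypeIQuantSubcubicExp/Lines/smooth_silence.lean` (v1.1, idea-crit-4 RE-STAMP PASS 2026-08-29T07:46Z)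
carries the stub Sv♯ `stub_vorticityTransport : VorticityTransport` («size M; CALCULUS + the tree's PROVED vorticity
formulation»): for `M₁ ≥ 1`, `γ > 0` there is `B = B(M₁) ≥ 1` such that a classical solution on `[0, T]` with the SHARP box
bound at scale `σ` on `[t, t₁] × B(y, ρ)` (`0 ≤ t < t₁ ≤ T`) puts the pair `(curl u, u)` in the DRIFT–STRETCH class on the same
box.  Proof with `B := (‖curlCLM‖ + 1) M₁` over the landed objects (`…SmoothSilenceDefs`): joint smoothness of `curl u` on
`[t, t₁] × ℝ³` (`IsSmoothSpaceTimeOn.isSmoothSpaceTimeOn_vorticity`) and of `u` (restriction); `‖Dʲ curl u‖ ≤ κ‖Dʲ⁺¹u‖ ≤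
κ M₁ σ^{-(j+2)}` for `j ≤ 5` (`norm_iteratedFDeriv_curl_le`); the `v = u` bounds and the three Hölder moduli forwarded with
`M₁ ≤ B`; and the vorticity equation of the restricted classical solution
(`IsClassicalNSSolutionOn.isVorticitySolutionOn_zero_force`, Majda–Bertozzi (2.110)) rearranged into the class's form
`∂ₛω = Δω + Du·ω − Dω·u`.  Same method as the tree's Sv `SilencingCost.vorticityInequality` (p706103).

HONEST FRAME: vector calculus for smooth classical solutions; it closes one registered stub of a line four levels below the
crux; nothing here bears on E2, 24077's truth, W7 or Navier–Stokes regularity (OPEN / not proved).  pub-ns-dss typer (g38),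
`--supports stmt-NavierStokesRegularity-24077`.
-/

noncomputable section

set_option linter.dupNamespace false

namespace Summit.NavierStokesRegularity.NavierStokesRegularity.Cruxes.TypeIQuantSubcubicExp.SmoothSilence

open MeasureTheory Set Function Filter Topology Metric
open scoped ENNReal NNReal Laplacian RealInnerProductSpace
open Literature.Analysis Literature.Analysis.FluidPDE

/-- **Sv♯ — `stub_vorticityTransport : VorticityTransport` (BY NAME)**, with `B := (‖curlCLM‖ + 1) M₁`. -/
theorem stub_vorticityTransport : VorticityTransport := by
  intro M₁ γ hM₁ _hγ
  set κ : ℝ := ‖(curlCLM : (EuclideanSpace ℝ (Fin 3) →L[ℝ] EuclideanSpace ℝ (Fin 3)) →L[ℝ]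
      EuclideanSpace ℝ (Fin 3))‖ with hκ
  have hκ0 : 0 ≤ κ := by rw [hκ]; positivity
  have hM₁0 : 0 ≤ M₁ := by linarith
  refine ⟨(κ + 1) * M₁, by nlinarith, ?_⟩
  intro T u p hcl y σ ρ t t₁ hσ ht htt₁ ht₁T hbox
  have hBM : M₁ ≤ (κ + 1) * M₁ := by nlinarith
  have hBκ : κ * M₁ ≤ (κ + 1) * M₁ := by nlinarith
  -- the classical solution restricted to `[t, t₁]` and its vorticity formulation
  have hsub : Icc t t₁ ⊆ Icc 0 T := Icc_subset_Icc ht ht₁T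
  have hU : UniqueDiffOn ℝ (Icc t t₁) := uniqueDiffOn_Icc htt₁
  have h' : IsClassicalNSSolutionOn (Icc t t₁) 1 0 u p := hcl.mono hsub hU
  have hcl' : Icc t t₁ ⊆ closure (interior (Icc t t₁)) := by
    rw [interior_Icc, closure_Ioo htt₁.ne]
  have hvort : IsVorticitySolutionOn (Icc t t₁) 1 u := h'.isVorticitySolutionOn_zero_force hU hcl'
  have hvdef : (fun s => curl (u s)) = vorticity u := rfl
  refine ⟨?_, h'.smooth_velocity, ?_⟩
  · rw [hvdef]
    exact h'.smooth_velocity.isSmoothSpaceTimeOn_vorticity hU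
  intro s hs x hx
  obtain ⟨hsp, hmod⟩ := hbox
  have hsm : ∀ n : ℕ, ContDiff ℝ n (u s) := fun n => (h'.contDiff_velocity hs).of_le (by norm_cast; exact le_top)
  refine ⟨?_, ?_, ?_, ?_⟩
  · -- `‖Dʲ curl u‖ ≤ κ ‖Dʲ⁺¹ u‖ ≤ κ M₁ σ^{-(j+2)} ≤ B σ^{-(j+2)}` for `j ≤ 5`
    intro j hj
    have hpow : 0 < σ ^ (-((j : ℝ) + 2)) := Real.rpow_pos_of_pos hσ _
    have hu := hsp s hs x hx (j + 1) (by omega)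
    have hexp : (-((((j + 1 : ℕ) : ℝ)) + 1)) = -((j : ℝ) + 2) := by push_cast; ring
    rw [hexp] at hu
    calc ‖iteratedFDeriv ℝ j (curl (u s)) x‖ ≤ κ * ‖iteratedFDeriv ℝ (j + 1) (u s) x‖ :=
          norm_iteratedFDeriv_curl_le (hsm (j + 1)) x
      _ ≤ κ * (M₁ * σ ^ (-((j : ℝ) + 2))) := mul_le_mul_of_nonneg_left hu hκ0
      _ = κ * M₁ * σ ^ (-((j : ℝ) + 2)) := by ring
      _ ≤ (κ + 1) * M₁ * σ ^ (-((j : ℝ) + 2)) := mul_le_mul_of_nonneg_right hBκ hpow.le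
  · -- the coefficient bounds `j ≤ 4`
    intro j hj
    have hpow : 0 < σ ^ (-((j : ℝ) + 1)) := Real.rpow_pos_of_pos hσ _
    exact (hsp s hs x hx j (by omega)).trans (mul_le_mul_of_nonneg_right hBM hpow.le)
  · -- the three Hölder moduli, forwarded
    intro s' hs'
    obtain ⟨h0, h1, h2⟩ := hmod s hs s' hs' x hx
    have hfac : ∀ e : ℝ, 0 ≤ (|s - s'| / σ ^ 2) ^ γ := fun _ => Real.rpow_nonneg (by positivity) _
    have hw : ∀ e : ℝ, M₁ * σ ^ e * (|s - s'| / σ ^ 2) ^ γ ≤ (κ + 1) * M₁ * σ ^ e * (|s - s'| / σ ^ 2) ^ γ :=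
      fun e => mul_le_mul_of_nonneg_right (mul_le_mul_of_nonneg_right hBM (Real.rpow_pos_of_pos hσ _).le) (hfac e)
    exact ⟨h0.trans (hw _), h1.trans (hw _), h2.trans (hw _)⟩
  · -- the vorticity equation in drift–stretch form
    have heq := hvort.vorticity_eq s hs x
    rw [one_smul, convect_apply, convect_apply, vorticity_apply] at heq
    -- `∂ω + Dω·u = Du·ω + Δω`  ⇒  `∂ω = Δω + Du·ω − Dω·u`
    rw [show timeDerivWithin (Icc t t₁) (fun s => curl (u s)) s x = timeDerivWithin (Icc t t₁) (vorticity u) s x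
        from rfl]
    rw [eq_sub_iff_add_eq, heq]
    abel

end Summit.NavierStokesRegularity.NavierStokesRegularity.Cruxes.TypeIQuantSubcubicExp.SmoothSilence

end
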